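import Summits.ResolutionOfSingularities.ResolutionOfSingularities.Theorems.FrobeniusLadderFInjectiveMacaulayficationTauFloorBXChartIdent
import Summits.ResolutionOfSingularities.ResolutionOfSingularities.Theorems.FrobeniusLadderFInjectiveMacaulayficationTauFloorBXChartNotFull
import Summits.ResolutionOfSingularities.ResolutionOfSingularities.Theorems.FrobeniusLadderFInjectiveMacaulayficationTauFloorInputNotFull
import Summits.ResolutionOfSingularities.ResolutionOfSingularities.Theorems.FrobeniusLadderFInjectiveMacaulayficationP2d4BSpecimen
import HarnessLib

/-!
# (N2)(E) ROW #3 INPUT SIDE, first half: the τ-floor `S′ = Bl_τ X → Spec 𝒪_{X,v}` of P2d4B is NOT F(4)-iso — it has a NON-FULL stalk over the closed point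
# (crux `FInjectiveMacaulayfication` stmt-ResolutionOfSingularities-15315, chain w45a; res-L1-w45a-plan-1 g19 RULING R19.6 (3) «(N2) ROW #3 INPUT LEGALITY → stub-2;
# START WITH (N2)(E) `tauFloor_P2d4B_not_full`»; pattern = res-L1-w45a-stub-1's `TauFloorInputNotFull.tauFloor_not_full` (p624800, row #1); seat res-L1-w45a-stub-2 g8)

[OURS · L1 W4.5a] Support file (`--supports stmt-ResolutionOfSingularities-15315 --as helper`); replaces the role of NO printed item; NOT a statement of any
manuscript; def-free; UNCONDITIONAL; characteristic-free (any field `k` — the row's own `CharP k 2` is not needed for the non-FULL point). AI-written (AI review is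
weaker than expert review).

LETTERING of row #3 (`TauFloorP2d4BRow.tauFloor_P2d4B_row`, p630677): `X = Spec A₀`, `A₀ = k[X0..X4]/(f)`, `f = X4² + X0²X4 + X1³ + X2³ + X3⁵`, `v` the vertex,
`τ = (x̄, ȳ, ū, t̄², z̄)`, `I = τ̃|_{Spec 𝒪_{X,v}}`.
* §1 ★ `exists_prime_not_fullCl_blowupAlgebra` — a prime `Q ∋ x̄/1` of the chart ring `A₀[τ/x̄]` with `A₀[τ/x̄]_Q` NOT FULL: the image under
  `TauFloorBXChartIdent.exists_chartEquiv : T₂ ≃+* A₀[τ/x̄]` (p635410) of the prime `𝔮 = ker κ = (x, t, w, z′)` of the monic tower `T₂ = k[x,y′,u′,w][t][z′]`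
  (`TauFloorBXChartNotFull.not_fullCl_localization_kerKillMap`, p634876: `dim 2`, `(t̄z̄′)² ∈ (x̄², w̄²)`, `t̄z̄′ ∉ (x̄, w̄)`).
* §2 `span_range_X_le_radical_tau` (`𝔪_v ⊆ √τ`), ★ `exists_point_over_vertex_not_fullCl` — a point `b ∈ Bl_τ X` over `v` with `𝒪_{Bl,b}` NOT FULL
  (`TauFloorInputNotFull.exists_point_over_centre_not_fullCl`, chart–stalk dictionary).
* §3 ★★ `tauFloor_P2d4B_not_full` — for EVERY blowing up `g : S′ → Spec 𝒪_{X,v}` along `I`: `∃ s : S′, g s = closed point ∧ ¬ FullCl 2 (𝒪_{S′,s})`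
  (`TauFloorInputNotFull.exists_not_fullCl_of_isBlowup_comap_fromSpecStalk`), in the binder shape of row #3. So the (pos) conjunct of `f4pos_row_three` is in the
  kernel; the (legal) conjunct (`I ≠ ⊥`, `Supp I ⊆ Regᶜ`, `S′` regular off the closed fibre, CM everywhere — the other four charts) is the remaining (N2) half.
[folklore assembly; cite: GortzWedhorn2020, (13.19), Prop. 13.91 (2)] [cite: StacksProject, Tag 0804; Tag 01J7] [cite: Temkin2008, §2.1]
-/

-- single-problem summit: the doubled namespace component is forced
set_option linter.dupNamespace false

noncomputable section

namespace Summit.ResolutionOfSingularities.ResolutionOfSingularities.Theorems.FInjectiveMacaulayfication.TauFloorP2d4BNotFull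

open CategoryTheory AlgebraicGeometry TopologicalSpace IsLocalRing MvPolynomial
open Literature.AlgebraicGeometry.Resolution
open Summit.ResolutionOfSingularities.ResolutionOfSingularities.Theorems.FInjectiveMacaulayfication
open SliceableCentre

variable (k : Type) [Field k]

/-! ## §1 A NON-FULL prime of the chart ring `A₀[τ/x̄]` through `x̄/1` -/

set_option maxHeartbeats 800000 in
set_option synthInstance.maxHeartbeats 400000 in
-- the chart ring `blowupAlgebra τ (Ideal.Quotient.mk _ (X 0))`: slow instance paths (as in `…TauFloorBXChartIdent`)
/-- ★ **A prime `Q ∋ x̄/1` of `A₀[τ/x̄]` with `A₀[τ/x̄]_Q` NOT FULL**: the image of `𝔮 = (x, t, w, z′) ⊂ T₂` under `T₂ ≃+* A₀[τ/x̄]`. Over ANY field `k`.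
[OURS · assembly of p634876 + p635410] -/
theorem exists_prime_not_fullCl_blowupAlgebra (f : MvPolynomial (Fin 5) k) (hf : f = X 4 ^ 2 + X 0 ^ 2 * X 4 + X 1 ^ 3 + X 2 ^ 3 + X 3 ^ 5) :
    ∃ Q : Ideal (blowupAlgebra (Ideal.span {Ideal.Quotient.mk (Ideal.span {f}) (X 0), Ideal.Quotient.mk (Ideal.span {f}) (X 1), Ideal.Quotient.mk (Ideal.span {f}) (X 2), Ideal.Quotient.mk (Ideal.span {f}) (X 3) ^ 2, Ideal.Quotient.mk (Ideal.span {f}) (X 4)} : Ideal (MvPolynomial (Fin 5) k ⧸ Ideal.span {f})) (Ideal.Quotient.mk (Ideal.span {f}) (X 0))), ∃ _ : Q.IsPrime,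
      algebraMap (MvPolynomial (Fin 5) k ⧸ Ideal.span {f}) (blowupAlgebra (Ideal.span {Ideal.Quotient.mk (Ideal.span {f}) (X 0), Ideal.Quotient.mk (Ideal.span {f}) (X 1), Ideal.Quotient.mk (Ideal.span {f}) (X 2), Ideal.Quotient.mk (Ideal.span {f}) (X 3) ^ 2, Ideal.Quotient.mk (Ideal.span {f}) (X 4)} : Ideal (MvPolynomial (Fin 5) k ⧸ Ideal.span {f})) (Ideal.Quotient.mk (Ideal.span {f}) (X 0))) (Ideal.Quotient.mk (Ideal.span {f}) (X 0)) ∈ Q ∧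
        ¬ FullCl 2 (Localization.AtPrime Q) := by
  classical
  set h₁ : Polynomial (MvPolynomial (Fin 4) k) := Polynomial.X ^ 2 - Polynomial.C (X 0 * X 3) with hh₁
  set h₂ : Polynomial (AdjoinRoot h₁) := Polynomial.X ^ 2 + (Polynomial.C (algebraMap (MvPolynomial (Fin 4) k) (AdjoinRoot h₁) (X 0)) * Polynomial.X +
      Polynomial.C (algebraMap (MvPolynomial (Fin 4) k) (AdjoinRoot h₁) (X 0 * (X 1 ^ 3 + X 2 ^ 3)) +
        AdjoinRoot.root h₁ * algebraMap (MvPolynomial (Fin 4) k) (AdjoinRoot h₁) (X 3 ^ 2))) with hh₂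
  obtain ⟨κ, hκ⟩ := TauFloorBXChartAlgebra.exists_killMap k h₁ hh₁ h₂ hh₂
  obtain ⟨e, -, heX, -, -⟩ := TauFloorBXChartIdent.exists_chartEquiv k f hf h₁ hh₁ h₂ hh₂
  haveI h𝔮 : (RingHom.ker κ).IsPrime := RingHom.ker_isPrime κ
  set Q : Ideal (blowupAlgebra (Ideal.span {Ideal.Quotient.mk (Ideal.span {f}) (X 0), Ideal.Quotient.mk (Ideal.span {f}) (X 1), Ideal.Quotient.mk (Ideal.span {f}) (X 2), Ideal.Quotient.mk (Ideal.span {f}) (X 3) ^ 2, Ideal.Quotient.mk (Ideal.span {f}) (X 4)} : Ideal (MvPolynomial (Fin 5) k ⧸ Ideal.span {f})) (Ideal.Quotient.mk (Ideal.span {f}) (X 0))) := (RingHom.ker κ).comap e.symm.toRingHom with hQ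
  haveI hQp : Q.IsPrime := Ideal.IsPrime.comap _
  have hQe : Q.comap e.toRingHom = RingHom.ker κ := by
    ext t
    rw [Ideal.mem_comap, hQ, Ideal.mem_comap, RingEquiv.toRingHom_eq_coe, RingEquiv.coe_toRingHom, RingEquiv.toRingHom_eq_coe,
      RingEquiv.coe_toRingHom, RingEquiv.symm_apply_apply]
  refine ⟨Q, hQp, ?_, ?_⟩
  · -- `x̄/1 = e(x)` and `x ∈ ker κ`
    have hex : e (algebraMap (MvPolynomial (Fin 4) k) (AdjoinRoot h₂) (X 0)) =
        algebraMap (MvPolynomial (Fin 5) k ⧸ Ideal.span {f}) (blowupAlgebra (Ideal.span {Ideal.Quotient.mk (Ideal.span {f}) (X 0), Ideal.Quotient.mk (Ideal.span {f}) (X 1), Ideal.Quotient.mk (Ideal.span {f}) (X 2), Ideal.Quotient.mk (Ideal.span {f}) (X 3) ^ 2, Ideal.Quotient.mk (Ideal.span {f}) (X 4)} : Ideal (MvPolynomial (Fin 5) k ⧸ Ideal.span {f})) (Ideal.Quotient.mk (Ideal.span {f}) (X 0))) (Ideal.Quotient.mk (Ideal.span {f}) (X 0)) := Subtype.ext (heX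 0)
    rw [hQ, Ideal.mem_comap, RingEquiv.toRingHom_eq_coe, RingEquiv.coe_toRingHom, ← hex, RingEquiv.symm_apply_apply, RingHom.mem_ker,
      TauFloorBXChartNotFull.killMap_algebraMap k h₁ h₂ κ hκ, TauFloorBXChartAlgebra.killXW_X]
    simp
  · intro hfull
    obtain ⟨eQ⟩ := E8Char5FiModel.nonempty_ringEquiv_localization_comap e Q
    haveI : (Q.comap e.toRingHom).IsPrime := Ideal.IsPrime.comap _
    exact TauFloorBXChartNotFull.not_fullCl_localization_kerKillMap k h₁ hh₁ h₂ hh₂ κ hκ (Q.comap e.toRingHom) hQe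
      (WFixAtNonClosedDimTwo.fullCl_of_ringEquiv 2 eQ.symm hfull)

/-! ## §2 A point of `Bl_τ X` over the vertex with a NON-FULL stalk -/

/-- `𝔪_v = (x̄0, …, x̄4) ⊆ √τ` (`t̄² ∈ τ`). [plumbing] -/
theorem span_range_X_le_radical_tau (f : MvPolynomial (Fin 5) k) :
    Ideal.span (Set.range fun j : Fin 5 => Ideal.Quotient.mk (Ideal.span {f}) (X j)) ≤ (Ideal.span {Ideal.Quotient.mk (Ideal.span {f}) (X 0), Ideal.Quotient.mk (Ideal.span {f}) (X 1),
          Ideal.Quotient.mk (Ideal.span {f}) (X 2), Ideal.Quotient.mk (Ideal.span {f}) (X 3) ^ 2, Ideal.Quotient.mk (Ideal.span {f}) (X 4)} : Ideal (MvPolynomial (Fin 5) k ⧸ Ideal.span {f})).radical := by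
  rw [Ideal.span_le]
  rintro _ ⟨j, rfl⟩
  fin_cases j
  · exact Ideal.le_radical (Ideal.subset_span (by simp))
  · exact Ideal.le_radical (Ideal.subset_span (by simp))
  · exact Ideal.le_radical (Ideal.subset_span (by simp))
  · exact ⟨2, Ideal.subset_span (by simp)⟩
  · exact Ideal.le_radical (Ideal.subset_span (by simp))

set_option synthInstance.maxHeartbeats 400000 in
-- as above
/-- ★ **A point of `Bl_τ X` over the vertex `v` with a NON-FULL stalk** (the image of `𝔮` in the `D(x̄)` chart). Over ANY field `k`. [OURS · assembly] -/
theorem exists_point_over_vertex_not_fullCl (f : MvPolynomial (Fin 5) k) (hf : f = X 4 ^ 2 + X 0 ^ 2 * X 4 + X 1 ^ 3 + X 2 ^ 3 + X 3 ^ 5)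
    (v : Spec (.of (MvPolynomial (Fin 5) k ⧸ Ideal.span {f})))
    (hv : v.asIdeal = Ideal.span (Set.range fun j : Fin 5 => Ideal.Quotient.mk (Ideal.span {f}) (X j))) :
    ∃ b : ↥(affineBlowup (Ideal.span {Ideal.Quotient.mk (Ideal.span {f}) (X 0), Ideal.Quotient.mk (Ideal.span {f}) (X 1),
          Ideal.Quotient.mk (Ideal.span {f}) (X 2), Ideal.Quotient.mk (Ideal.span {f}) (X 3) ^ 2, Ideal.Quotient.mk (Ideal.span {f}) (X 4)} : Ideal (MvPolynomial (Fin 5) k ⧸ Ideal.span {f}))),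
      (affineBlowup.π _).base b = v ∧
        ¬ FullCl 2 ((affineBlowup (Ideal.span {Ideal.Quotient.mk (Ideal.span {f}) (X 0), Ideal.Quotient.mk (Ideal.span {f}) (X 1),
          Ideal.Quotient.mk (Ideal.span {f}) (X 2), Ideal.Quotient.mk (Ideal.span {f}) (X 3) ^ 2, Ideal.Quotient.mk (Ideal.span {f}) (X 4)} : Ideal (MvPolynomial (Fin 5) k ⧸ Ideal.span {f}))).presheaf.stalk b) := by
  classical
  obtain ⟨Q, hQ, hxQ, hbad⟩ := exists_prime_not_fullCl_blowupAlgebra k f hf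
  obtain ⟨b, hb, hbadb⟩ := TauFloorInputNotFull.exists_point_over_centre_not_fullCl _ _ (Ideal.subset_span (by simp)) 2 Q hxQ hbad
  refine ⟨b, ?_, hbadb⟩
  haveI hmax : v.asIdeal.IsMaximal := by
    rw [hv]; exact DoublePointFermatCubicGerm.isMaximal_origin k f (P2d4BSpecimen.constantCoeff_f k f hf)
  have h1 : v.asIdeal ≤ ((affineBlowup.π _).base b).asIdeal := by
    rw [hv]
    refine (span_range_X_le_radical_tau k f).trans ?_
    exact (((affineBlowup.π _).base b).2.radical_le_iff).mpr hb
  exact (PrimeSpectrum.ext (hmax.eq_of_le ((affineBlowup.π _).base b).2.ne_top h1)).symm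

/-! ## §3 ★★ The τ-floor of P2d4B is NOT F(4)-iso -/

/-- ★★ **(N2)(E): the τ-floor of P2d4B is NOT an F(4)-iso input.** For EVERY blowing up `g : S′ → Spec 𝒪_{X,v}` along `I = τ̃|_{Spec 𝒪_{X,v}}` there is a point
`s ∈ S′` over the closed point whose local ring is NOT FULL — in the binder shape of row #3 (`TauFloorP2d4BRow.tauFloor_P2d4B_row`). Over ANY field `k`.
[OURS · assembly; cite: GortzWedhorn2020, Prop. 13.91 (2)] [cite: Temkin2008, §2.1] -/
theorem tauFloor_P2d4B_not_full (f : MvPolynomial (Fin 5) k) (hf : f = X 4 ^ 2 + X 0 ^ 2 * X 4 + X 1 ^ 3 + X 2 ^ 3 + X 3 ^ 5)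
    (v : Spec (.of (MvPolynomial (Fin 5) k ⧸ Ideal.span {f})))
    (hv : v.asIdeal = Ideal.span (Set.range fun j : Fin 5 => Ideal.Quotient.mk (Ideal.span {f}) (X j)))
    (S' : Scheme.{0}) (g : S' ⟶ Spec ((Spec (.of (MvPolynomial (Fin 5) k ⧸ Ideal.span {f}))).presheaf.stalk v))
    (hg : IsBlowup g ((affineBlowup.idealSheaf
        (Ideal.span {Ideal.Quotient.mk (Ideal.span {f}) (X 0), Ideal.Quotient.mk (Ideal.span {f}) (X 1),
          Ideal.Quotient.mk (Ideal.span {f}) (X 2), Ideal.Quotient.mk (Ideal.span {f}) (X 3) ^ 2, Ideal.Quotient.mk (Ideal.span {f}) (X 4)})).comap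
        ((Spec (.of (MvPolynomial (Fin 5) k ⧸ Ideal.span {f}))).fromSpecStalk v))) :
    ∃ s : S', g.base s = closedPoint ((Spec (.of (MvPolynomial (Fin 5) k ⧸ Ideal.span {f}))).presheaf.stalk v) ∧ ¬ FullCl 2 (S'.presheaf.stalk s) :=
  TauFloorInputNotFull.exists_not_fullCl_of_isBlowup_comap_fromSpecStalk 2 v (affineBlowup.isBlowup _)
    (exists_point_over_vertex_not_fullCl k f hf v hv) hg

end Summit.ResolutionOfSingularities.ResolutionOfSingularities.Theorems.FInjectiveMacaulayfication.TauFloorP2d4BNotFull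

end
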